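import Literature.Analysis.PDE.WeightedPoincareInequality
import Literature.Analysis.FluidPDE.RadialCalculus
import Mathlib.Geometry.Manifold.PartitionOfUnity
import Mathlib.Topology.MetricSpace.Thickening
import Mathlib.Analysis.SpecialFunctions.Pow.Real
import Mathlib.Analysis.SpecialFunctions.Log.Deriv
import Mathlib.Analysis.SpecialFunctions.Sqrt
import HarnessLib

/-!
# The weighted Poincaré inequality near a spherical boundary
# (Chruściel–Delay 2003, Appendix C, Prop. C.4, for the flat ball)

Sequel of `WeightedPoincareInequality.lean` (Lemma C.1 / Prop. C.2 of Chruściel–Delay 2003 for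
globally `C²` weights). Here:

* `integral_exp_weight_mul_sq_le_of_subset` — **Prop. C.2 localised**: the weights `v, w` need
  only be `C²` on an open set `U ⊇ supp u` (cut-off equal to `1` near `supp u`);
* the boundary-distance weight of the ball `B(z₀, ρ)`: with `x = ρ − |z − z₀|` and
  `v = −s/x + t log x` (a radial function, `RadialCalculus.lean`), the pointwise bound
  `|∇v|² + Δv ≥ (s² − ε)/x⁴` on the shell `{0 < x < x₁}` for `x₁ = x₁(ε, s, t, ρ, n)` small
  (`weight_lower_bound`), and
* `integral_shell_weight_mul_sq_le` — **Prop. C.4 on the ball**: for every `ε > 0` there is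
  `x₁ > 0` such that for all `u ∈ C¹_c` supported in the shell `{ρ − x₁ < |z − z₀| < ρ}`,
  `(s² − ε) ∫ e^{−2s/x} x^{2t−4} u² ≤ ∫ e^{−2s/x} x^{2t} |∇u|²`.

This is the inequality that makes the adjoint `P*` of the linearised constraint map coercive
near `∂Ω` in the exponentially weighted spaces of Chruściel–Delay (§3, §5), independently of the
absence of KIDs. Everything is proved; no statements of `Prop` type are introduced.

## References

* P. T. Chruściel, E. Delay, Mém. Soc. Math. Fr. 94 (2003), Appendix C, Prop. C.2, Prop. C.4.
  [ChruscielDelay2003]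
-/

noncomputable section

open Set Function Filter MeasureTheory Metric
open scoped Topology ContDiff Manifold

namespace Literature.Analysis.PDE

namespace WeightedPoincare

variable {E : Type*} [NormedAddCommGroup E] [InnerProductSpace ℝ E] [FiniteDimensional ℝ E]
  [MeasurableSpace E] [BorelSpace E] {ι : Type*} [Fintype ι] (b : OrthonormalBasis ι ℝ E)

/-! ### Cut-offs and localisation of Prop. C.2 -/

omit [MeasurableSpace E] [BorelSpace E] in
/-- A smooth compactly supported cut-off equal to `1` near a compact set `K` and supported in an
open `U ⊇ K`. [folklore] -/
theorem exists_cutoff_eq_one_nhdsSet {K U : Set E} (hK : IsCompact K) (hU : IsOpen U) (hKU : K ⊆ U) :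
    ∃ χ : E → ℝ, ContDiff ℝ ∞ χ ∧ HasCompactSupport χ ∧ tsupport χ ⊆ U ∧
      ∀ᶠ x in 𝓝ˢ K, χ x = 1 := by
  obtain ⟨δ, hδ, hδU⟩ := hK.exists_cthickening_subset_open hU hKU
  have hd : Disjoint (thickening δ K)ᶜ K :=
    disjoint_compl_left.mono_right (self_subset_thickening hδ K)
  obtain ⟨f, hf0, hf1, -⟩ :=
    exists_contMDiffMap_zero_one_nhds_of_isClosed (𝓘(ℝ, E)) (n := (⊤ : ℕ∞))
      isOpen_thickening.isClosed_compl hK.isClosed hd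
  have hsupp : support (f : E → ℝ) ⊆ thickening δ K := fun x hx ↦ by
    by_contra hx'
    exact hx (hf0.self_of_nhdsSet x hx')
  have htsupp : tsupport (f : E → ℝ) ⊆ cthickening δ K :=
    (closure_mono hsupp).trans (closure_thickening_subset_cthickening δ K)
  exact ⟨f, contMDiff_iff_contDiff.1 f.contMDiff,
    hK.cthickening.of_isClosed_subset (isClosed_tsupport _) htsupp, htsupp.trans hδU, hf1⟩

omit [InnerProductSpace ℝ E] [FiniteDimensional ℝ E] [MeasurableSpace E] [BorelSpace E] in
/-- The product `χ v` of a cut-off `χ` supported in `U` with a function `v` of class `C^n` on the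
open set `U` is globally `C^n`. [folklore] -/
theorem contDiff_cutoff_mul [NormedSpace ℝ E] {χ v : E → ℝ} {U : Set E} {n : ℕ∞ω} (hU : IsOpen U)
    (hχ : ContDiff ℝ n χ) (hχU : tsupport χ ⊆ U) (hv : ContDiffOn ℝ n v U) :
    ContDiff ℝ n fun z ↦ χ z * v z := by
  refine contDiff_iff_contDiffAt.2 fun z ↦ ?_
  by_cases hz : z ∈ U
  · exact hχ.contDiffAt.mul ((hv z hz).contDiffAt (hU.mem_nhds hz))
  · have hz' : z ∉ tsupport χ := fun h ↦ hz (hχU h)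
    have hev : (fun z ↦ χ z * v z) =ᶠ[𝓝 z] fun _ ↦ 0 := by
      filter_upwards [(isClosed_tsupport χ).isOpen_compl.mem_nhds hz'] with y hy
      rw [image_eq_zero_of_notMem_tsupport hy, zero_mul]
    exact (contDiffAt_const (c := (0 : ℝ))).congr_of_eventuallyEq hev

omit [InnerProductSpace ℝ E] [FiniteDimensional ℝ E] [MeasurableSpace E] [BorelSpace E] in
/-- A continuous compactly supported `g` times a function continuous on an open `U ⊇ supp g` is
continuous. [folklore] -/
theorem continuous_mul_of_tsupport_subset [NormedSpace ℝ E] {g f : E → ℝ} {U : Set E}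
    (hU : IsOpen U) (hg : Continuous g) (hgU : tsupport g ⊆ U) (hf : ContinuousOn f U) :
    Continuous fun z ↦ g z * f z := by
  refine continuous_iff_continuousAt.2 fun z ↦ ?_
  by_cases hz : z ∈ U
  · exact hg.continuousAt.mul (hf.continuousAt (hU.mem_nhds hz))
  · have hz' : z ∉ tsupport g := fun h ↦ hz (hgU h)
    have hev : (fun z ↦ g z * f z) =ᶠ[𝓝 z] fun _ ↦ 0 := by
      filter_upwards [(isClosed_tsupport g).isOpen_compl.mem_nhds hz'] with y hy
      rw [image_eq_zero_of_notMem_tsupport hy, zero_mul]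
    exact (continuousAt_congr hev).2 continuousAt_const

omit [InnerProductSpace ℝ E] [FiniteDimensional ℝ E] [MeasurableSpace E] [BorelSpace E] in
/-- Off the support of `u`, both `u` and `∇u` vanish. [folklore] -/
theorem fderiv_apply_eq_zero_of_notMem_tsupport [NormedSpace ℝ E] {u : E → ℝ} {x : E} (hx : x ∉ tsupport u) (e : E) :
    fderiv ℝ u x e = 0 := by
  rw [fderiv_of_notMem_tsupport ℝ hx, _root_.zero_apply]

/-- **Prop. C.2 of Chruściel–Delay 2003, localised**: the weights need only be `C²` on an open
set containing the support of `u`. [cite: ChruscielDelay2003, Appendix C, Prop. C.2] -/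
theorem integral_exp_weight_mul_sq_le_of_subset {u v w : E → ℝ} {U : Set E} (hU : IsOpen U)
    (hu : ContDiff ℝ 1 u) (huc : HasCompactSupport u) (huU : tsupport u ⊆ U)
    (hv : ContDiffOn ℝ 2 v U) (hw : ContDiffOn ℝ 2 w U) :
    ∫ x, Real.exp (2 * v x) *
        ((∑ i, fderiv ℝ (fun y ↦ fderiv ℝ v y (b i)) x (b i)) +
          (∑ i, fderiv ℝ (fun y ↦ fderiv ℝ w y (b i)) x (b i)) +
          (∑ i, fderiv ℝ v x (b i) ^ 2) - ∑ i, fderiv ℝ w x (b i) ^ 2) * u x ^ 2 ≤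
      ∫ x, Real.exp (2 * v x) * ∑ i, fderiv ℝ u x (b i) ^ 2 := by
  obtain ⟨χ, hχ, -, hχU, hχ1⟩ := exists_cutoff_eq_one_nhdsSet (K := tsupport u) huc hU huU
  -- an open set `O ⊇ supp u` inside `U` on which `χ = 1`
  obtain ⟨O', hO'o, hKO', hO'1⟩ := mem_nhdsSet_iff_exists.1 hχ1
  set O : Set E := O' ∩ U with hO_def
  have hO : IsOpen O := hO'o.inter hU
  have hKO : tsupport u ⊆ O := fun x hx ↦ ⟨hKO' hx, huU hx⟩
  have hχO : ∀ x ∈ O, χ x = 1 := fun x hx ↦ hO'1 hx.1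
  -- the globalised weights
  set V : E → ℝ := fun z ↦ χ z * v z with hV
  set W : E → ℝ := fun z ↦ χ z * w z with hW
  have hχ2 : ContDiff ℝ 2 χ := hχ.of_le (by norm_cast)
  have hV2 : ContDiff ℝ 2 V := contDiff_cutoff_mul hU hχ2 hχU hv
  have hW2 : ContDiff ℝ 2 W := contDiff_cutoff_mul hU hχ2 hχU hw
  have hmain := integral_exp_weight_mul_sq_le_integral_exp_gradSq b hu huc hV2 hW2
  -- on `O` the globalised weights agree with `v`, `w` to second order
  have hVO : ∀ x ∈ O, V =ᶠ[𝓝 x] v := fun x hx ↦ by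
    filter_upwards [hO.mem_nhds hx] with y hy
    simp only [hV, hχO y hy, one_mul]
  have hWO : ∀ x ∈ O, W =ᶠ[𝓝 x] w := fun x hx ↦ by
    filter_upwards [hO.mem_nhds hx] with y hy
    simp only [hW, hχO y hy, one_mul]
  have hV0 : ∀ x ∈ O, V x = v x := fun x hx ↦ (hVO x hx).self_of_nhds
  have hV1 : ∀ x ∈ O, ∀ e, fderiv ℝ V x e = fderiv ℝ v x e := fun x hx e ↦ by
    rw [(hVO x hx).fderiv_eq]
  have hW1 : ∀ x ∈ O, ∀ e, fderiv ℝ W x e = fderiv ℝ w x e := fun x hx e ↦ by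
    rw [(hWO x hx).fderiv_eq]
  have hV2' : ∀ x ∈ O, ∀ e e', fderiv ℝ (fun y ↦ fderiv ℝ V y e) x e' =
      fderiv ℝ (fun y ↦ fderiv ℝ v y e) x e' := fun x hx e e' ↦ by
    have h : (fun y ↦ fderiv ℝ V y e) =ᶠ[𝓝 x] fun y ↦ fderiv ℝ v y e := by
      filter_upwards [hO.mem_nhds hx] with y hy
      exact hV1 y hy e
    rw [h.fderiv_eq]
  have hW2' : ∀ x ∈ O, ∀ e e', fderiv ℝ (fun y ↦ fderiv ℝ W y e) x e' =
      fderiv ℝ (fun y ↦ fderiv ℝ w y e) x e' := fun x hx e e' ↦ by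
    have h : (fun y ↦ fderiv ℝ W y e) =ᶠ[𝓝 x] fun y ↦ fderiv ℝ w y e := by
      filter_upwards [hO.mem_nhds hx] with y hy
      exact hW1 y hy e
    rw [h.fderiv_eq]
  -- hence the integrands agree everywhere (off `supp u` both vanish)
  have hL : (fun x ↦ Real.exp (2 * V x) *
      ((∑ i, fderiv ℝ (fun y ↦ fderiv ℝ V y (b i)) x (b i)) +
        (∑ i, fderiv ℝ (fun y ↦ fderiv ℝ W y (b i)) x (b i)) +
        (∑ i, fderiv ℝ V x (b i) ^ 2) - ∑ i, fderiv ℝ W x (b i) ^ 2) * u x ^ 2) =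
      fun x ↦ Real.exp (2 * v x) *
      ((∑ i, fderiv ℝ (fun y ↦ fderiv ℝ v y (b i)) x (b i)) +
        (∑ i, fderiv ℝ (fun y ↦ fderiv ℝ w y (b i)) x (b i)) +
        (∑ i, fderiv ℝ v x (b i) ^ 2) - ∑ i, fderiv ℝ w x (b i) ^ 2) * u x ^ 2 := by
    funext x
    by_cases hx : x ∈ tsupport u
    · have hxO := hKO hx
      simp only [hV0 x hxO, hV1 x hxO, hW1 x hxO, hV2' x hxO, hW2' x hxO]
    · simp only [image_eq_zero_of_notMem_tsupport hx]
      ring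
  have hR : (fun x ↦ Real.exp (2 * V x) * ∑ i, fderiv ℝ u x (b i) ^ 2) =
      fun x ↦ Real.exp (2 * v x) * ∑ i, fderiv ℝ u x (b i) ^ 2 := by
    funext x
    by_cases hx : x ∈ tsupport u
    · rw [hV0 x (hKO hx)]
    · simp only [fderiv_apply_eq_zero_of_notMem_tsupport hx]
      simp
  rw [hL, hR] at hmain
  exact hmain

/-! ### Radial weights: gradient and Laplacian of `F(|z|)` -/

section Radial

open Literature.Analysis.FluidPDE RealInnerProductSpace

omit [FiniteDimensional ℝ E] [MeasurableSpace E] [BorelSpace E] in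
/-- **Gradient and Laplacian of a radial function `F(|z|)`** off the origin, along an
orthonormal basis: `Σᵢ (∂ᵢ F(|·|))(z)² = F'(|z|)²` and
`Σᵢ ∂ᵢ∂ᵢ F(|·|)(z) = F''(|z|) + (n − 1) F'(|z|)/|z|` (`n = card ι = dim E`), for `F` with
derivatives `F₁`, `F₂` on an open set of radii `R ⊆ (0, ∞)` containing `|z|`. [folklore] -/
theorem radial_sums {F F₁ F₂ : ℝ → ℝ} {R : Set ℝ} (hR : IsOpen R) (hR0 : ∀ r ∈ R, 0 < r)
    (hF : ∀ r ∈ R, HasDerivAt F (F₁ r) r) (hF₁ : ∀ r ∈ R, HasDerivAt F₁ (F₂ r) r) {z : E}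
    (hz : ‖z‖ ∈ R) :
    (∑ i, fderiv ℝ (fun w : E ↦ F ‖w‖) z (b i) ^ 2 = F₁ ‖z‖ ^ 2) ∧
      ∑ i, fderiv ℝ (fun y : E ↦ fderiv ℝ (fun w : E ↦ F ‖w‖) y (b i)) z (b i) =
        F₂ ‖z‖ + (Fintype.card ι - 1 : ℝ) * F₁ ‖z‖ / ‖z‖ := by
  -- `F(|w|) = g(|w|²)` with `g = F ∘ √`
  set g : ℝ → ℝ := fun σ ↦ F (Real.sqrt σ) with hg
  set g₁ : ℝ → ℝ := fun σ ↦ F₁ (Real.sqrt σ) / (2 * Real.sqrt σ) with hg₁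
  set U : Set ℝ := Ioi 0 ∩ Real.sqrt ⁻¹' R with hU
  have hUo : IsOpen U := isOpen_Ioi.inter (hR.preimage Real.continuous_sqrt)
  have hfun : (fun w : E ↦ F ‖w‖) = fun w ↦ g (‖w‖ ^ 2) := by
    funext w; simp [hg, Real.sqrt_sq (norm_nonneg w)]
  have hgd : ∀ σ ∈ U, HasDerivAt g (g₁ σ) σ := by
    rintro σ ⟨hσ0, hσR⟩
    have h := (hF _ hσR).comp σ (Real.hasDerivAt_sqrt (ne_of_gt hσ0))
    refine h.congr_deriv ?_
    simp only [hg₁]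
    ring
  have hz0 : 0 < ‖z‖ := hR0 _ hz
  have hzne : z ≠ 0 := norm_pos_iff.1 hz0
  have hσ : ‖z‖ ^ 2 ∈ U := ⟨mem_Ioi.2 (by positivity), by simpa [Real.sqrt_sq (norm_nonneg z)] using hz⟩
  have hsq : Real.sqrt (‖z‖ ^ 2) = ‖z‖ := Real.sqrt_sq (norm_nonneg z)
  -- the derivative of `g₁` at `|z|²`
  set σ₀ : ℝ := ‖z‖ ^ 2 with hσ₀
  have hσ₀0 : 0 < σ₀ := by positivity
  set g₂ : ℝ := F₂ ‖z‖ / (4 * σ₀) - F₁ ‖z‖ / (4 * σ₀ * ‖z‖) with hg₂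
  have hg₁d : HasDerivAt g₁ g₂ σ₀ := by
    have h1 : HasDerivAt (fun σ ↦ F₁ (Real.sqrt σ)) (F₂ ‖z‖ * (1 / (2 * ‖z‖))) σ₀ := by
      have h := (hF₁ _ hz)
      rw [← hsq] at h
      have h' := h.comp σ₀ (Real.hasDerivAt_sqrt (ne_of_gt hσ₀0))
      rw [hsq] at h'
      exact h'
    have h2 : HasDerivAt (fun σ ↦ (2 * Real.sqrt σ)⁻¹) (-(2 * (1 / (2 * ‖z‖))) / (2 * ‖z‖) ^ 2) σ₀ := by
      have h := ((Real.hasDerivAt_sqrt (ne_of_gt hσ₀0)).const_mul 2).inv (by rw [hsq]; positivity)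
      rw [hsq] at h
      exact h
    have h := h1.mul h2
    have hfun₁ : g₁ = fun σ ↦ F₁ (Real.sqrt σ) * (2 * Real.sqrt σ)⁻¹ := by
      funext σ; simp only [hg₁, div_eq_mul_inv]
    rw [hfun₁]
    refine h.congr_deriv ?_
    rw [hsq, hg₂, hσ₀]
    field_simp
    ring
  -- the radial formulas of `RadialCalculus.lean`
  have hd1 : ∀ a : E, fderiv ℝ (fun w : E ↦ g (‖w‖ ^ 2)) z a = 2 * g₁ σ₀ * ⟪z, a⟫ := fun a ↦
    fderiv_comp_norm_sq_apply (hgd _ hσ) a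
  have hd2 : ∀ a c : E, fderiv ℝ (fun w : E ↦ fderiv ℝ (fun w : E ↦ g (‖w‖ ^ 2)) w a) z c =
      4 * g₂ * ⟪z, a⟫ * ⟪z, c⟫ + 2 * g₁ σ₀ * ⟪a, c⟫ := fun a c ↦
    fderiv_fderiv_comp_norm_sq_apply hUo hgd hσ hg₁d a c
  have hg₁v : g₁ σ₀ = F₁ ‖z‖ / (2 * ‖z‖) := by
    show F₁ (Real.sqrt σ₀) / (2 * Real.sqrt σ₀) = _
    rw [hσ₀, hsq]
  have hparse : ∑ i, ⟪z, b i⟫ ^ 2 = ‖z‖ ^ 2 := b.sum_sq_inner_left z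
  have hone : ∀ i, ⟪b i, b i⟫ = (1 : ℝ) := fun i ↦ by
    rw [real_inner_self_eq_norm_sq, b.orthonormal.1 i, one_pow]
  rw [hfun]
  refine ⟨?_, ?_⟩
  · simp_rw [hd1, mul_pow, ← Finset.mul_sum, hparse, hg₁v]
    field_simp
  · have h4 : ∀ i, 4 * g₂ * ⟪z, b i⟫ * ⟪z, b i⟫ + 2 * g₁ σ₀ * ⟪b i, b i⟫ =
        4 * g₂ * ⟪z, b i⟫ ^ 2 + 2 * g₁ σ₀ := fun i ↦ by rw [hone]; ring
    simp_rw [hd2, h4, Finset.sum_add_distrib, ← Finset.mul_sum, hparse, Finset.sum_const,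
      Finset.card_univ, nsmul_eq_mul, hg₁v]
    simp only [hg₂, hσ₀]
    field_simp
    ring

end Radial

/-! ### The boundary weight `F(r) = −s/(ρ − r) + t log(ρ − r)` of the ball of radius `ρ` -/

section BdryWeight

/-- The weight `v = −s/x + t log x` of Chruściel–Delay, Prop. C.4, as a function of the radius
`r = ρ − x`. [cite: ChruscielDelay2003, Appendix C, Prop. C.4] -/
def bdryWeight (ρ s t : ℝ) (r : ℝ) : ℝ := -s * (ρ - r)⁻¹ + t * Real.log (ρ - r)

/-- Its first derivative `F' = −(s/x² + t/x)`. [cite: ChruscielDelay2003, Appendix C, Prop. C.4] -/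
def bdryWeight₁ (ρ s t : ℝ) (r : ℝ) : ℝ := -(s / (ρ - r) ^ 2 + t / (ρ - r))

/-- Its second derivative `F'' = −(2s/x³ + t/x²)`. [cite: ChruscielDelay2003, Appendix C, Prop. C.4] -/
def bdryWeight₂ (ρ s t : ℝ) (r : ℝ) : ℝ := -(2 * s / (ρ - r) ^ 3 + t / (ρ - r) ^ 2)

/-- `dF/dr = F₁`. [folklore] -/
theorem hasDerivAt_bdryWeight {ρ s t r : ℝ} (hr : r < ρ) :
    HasDerivAt (bdryWeight ρ s t) (bdryWeight₁ ρ s t r) r := by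
  have hx : ρ - r ≠ 0 := by linarith
  have h1 : HasDerivAt (fun r ↦ ρ - r) (-1) r := by
    simpa using (hasDerivAt_id r).const_sub ρ
  have hinv := h1.inv hx
  have hlog := h1.log hx
  have h := (hinv.const_mul (-s)).add (hlog.const_mul t)
  refine (h.congr_of_eventuallyEq (Eventually.of_forall fun y ↦ rfl)).congr_deriv ?_
  simp only [bdryWeight₁]
  field_simp
  ring

/-- `dF₁/dr = F₂`. [folklore] -/
theorem hasDerivAt_bdryWeight₁ {ρ s t r : ℝ} (hr : r < ρ) :
    HasDerivAt (bdryWeight₁ ρ s t) (bdryWeight₂ ρ s t r) r := by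
  have hx : ρ - r ≠ 0 := by linarith
  have h1 : HasDerivAt (fun r ↦ ρ - r) (-1) r := by
    simpa using (hasDerivAt_id r).const_sub ρ
  have h2 : HasDerivAt (fun r ↦ (ρ - r) ^ 2) (((2 : ℕ) : ℝ) * (ρ - r) ^ (2 - 1) * (-1)) r :=
    h1.pow 2
  have hinv2 := h2.inv (pow_ne_zero 2 hx)
  have hinv := h1.inv hx
  have h := ((hinv2.const_mul s).add (hinv.const_mul t)).neg
  have hfun : bdryWeight₁ ρ s t = fun y ↦ -(s * ((ρ - y) ^ 2)⁻¹ + t * (ρ - y)⁻¹) := by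
    funext y; simp only [bdryWeight₁, div_eq_mul_inv]
  rw [hfun]
  refine h.congr_deriv ?_
  simp only [bdryWeight₂, Nat.cast_ofNat]
  field_simp
  ring

/-- `F` is `C^∞` below `ρ`. [folklore] -/
theorem contDiffAt_bdryWeight {ρ s t r : ℝ} (hr : r < ρ) {n : ℕ∞ω} :
    ContDiffAt ℝ n (bdryWeight ρ s t) r := by
  have hx : ρ - r ≠ 0 := by linarith
  have h1 : ContDiffAt ℝ n (fun r ↦ ρ - r) r := contDiffAt_const.sub contDiffAt_id
  exact (contDiffAt_const.mul (h1.inv hx)).add (contDiffAt_const.mul (h1.log hx))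

/-- **The pointwise lower bound for `|∇v|² + Δv`** near the boundary: with `x = ρ − r ≤ x₁`,
`F₁² + F₂ + m F₁/r ≥ (s² − ε)/x⁴` as soon as `x (2|s||t| + 2|s| + |t| + 2|m|(|s| + |t|)/ρ) ≤ ε`,
`0 < x ≤ 1` and `r ≥ ρ/2`. [cite: ChruscielDelay2003, Appendix C, proof of Prop. C.4] -/
theorem weight_lower_bound {ρ s t ε x r m : ℝ} (hρ : 0 < ρ) (hx : 0 < x) (hx1 : x ≤ 1)
    (hr : ρ / 2 ≤ r) (hxr : x = ρ - r)
    (hxC : x * (2 * |s| * |t| + 2 * |s| + |t| + 2 * |m| * (|s| + |t|) / ρ) ≤ ε) :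
    (s ^ 2 - ε) / x ^ 4 ≤
      (-(s / x ^ 2 + t / x)) ^ 2 + -(2 * s / x ^ 3 + t / x ^ 2) + m * -(s / x ^ 2 + t / x) / r := by
  have hr0 : 0 < r := by linarith
  have hx4 : 0 < x ^ 4 := by positivity
  rw [div_le_iff₀ hx4]
  have key : ((-(s / x ^ 2 + t / x)) ^ 2 + -(2 * s / x ^ 3 + t / x ^ 2) +
      m * -(s / x ^ 2 + t / x) / r) * x ^ 4 =
      s ^ 2 + 2 * s * t * x + t ^ 2 * x ^ 2 - 2 * s * x - t * x ^ 2 -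
        m * (s * x ^ 2 + t * x ^ 3) / r := by
    field_simp
    ring
  rw [key]
  -- bounds for the error terms
  have hx2 : x ^ 2 ≤ x := by nlinarith
  have hx3 : x ^ 3 ≤ x := by nlinarith
  have e1 : -(2 * |s| * |t| * x) ≤ 2 * s * t * x := by
    have h : |2 * s * t * x| = 2 * |s| * |t| * x := by
      rw [abs_mul, abs_mul, abs_mul, abs_of_pos hx, abs_two]
    linarith [neg_abs_le (2 * s * t * x)]
  have e2 : -(2 * |s| * x) ≤ -(2 * s * x) := by
    have h : |2 * s * x| = 2 * |s| * x := by rw [abs_mul, abs_mul, abs_of_pos hx, abs_two]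
    linarith [le_abs_self (2 * s * x)]
  have e3 : -(|t| * x) ≤ -(t * x ^ 2) := by
    have hx2p : (0 : ℝ) < x ^ 2 := by positivity
    have h : |t * x ^ 2| = |t| * x ^ 2 := by rw [abs_mul, abs_of_pos hx2p]
    have h' : |t| * x ^ 2 ≤ |t| * x := mul_le_mul_of_nonneg_left hx2 (abs_nonneg t)
    linarith [le_abs_self (t * x ^ 2)]
  have e4 : -(2 * |m| * (|s| + |t|) / ρ * x) ≤ -(m * (s * x ^ 2 + t * x ^ 3) / r) := by
    have hb : |m * (s * x ^ 2 + t * x ^ 3) / r| ≤ 2 * |m| * (|s| + |t|) / ρ * x := by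
      rw [abs_div, abs_mul, abs_of_pos hr0]
      have hst : |s * x ^ 2 + t * x ^ 3| ≤ (|s| + |t|) * x := by
        calc |s * x ^ 2 + t * x ^ 3| ≤ |s * x ^ 2| + |t * x ^ 3| := abs_add_le _ _
          _ = |s| * x ^ 2 + |t| * x ^ 3 := by
              rw [abs_mul, abs_mul, abs_of_pos (by positivity : (0:ℝ) < x ^ 2),
                abs_of_pos (by positivity : (0:ℝ) < x ^ 3)]
          _ ≤ |s| * x + |t| * x := add_le_add (mul_le_mul_of_nonneg_left hx2 (abs_nonneg s))
              (mul_le_mul_of_nonneg_left hx3 (abs_nonneg t))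
          _ = (|s| + |t|) * x := by ring
      have hnum : |m| * |s * x ^ 2 + t * x ^ 3| ≤ |m| * ((|s| + |t|) * x) :=
        mul_le_mul_of_nonneg_left hst (abs_nonneg m)
      have hrinv : 1 / r ≤ 2 / ρ := by
        rw [div_le_div_iff₀ hr0 hρ]; linarith
      calc |m| * |s * x ^ 2 + t * x ^ 3| / r ≤ |m| * ((|s| + |t|) * x) / r :=
            div_le_div_of_nonneg_right hnum hr0.le
        _ = |m| * ((|s| + |t|) * x) * (1 / r) := by ring
        _ ≤ |m| * ((|s| + |t|) * x) * (2 / ρ) :=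
            mul_le_mul_of_nonneg_left hrinv (by positivity)
        _ = 2 * |m| * (|s| + |t|) / ρ * x := by ring
    linarith [le_abs_self (m * (s * x ^ 2 + t * x ^ 3) / r)]
  have hsum : x * (2 * |s| * |t| + 2 * |s| + |t| + 2 * |m| * (|s| + |t|) / ρ) =
      2 * |s| * |t| * x + 2 * |s| * x + |t| * x + 2 * |m| * (|s| + |t|) / ρ * x := by ring
  nlinarith [sq_nonneg (t * x)]

end BdryWeight

/-! ### Prop. C.4 on the ball -/

section Shell

omit [MeasurableSpace E] [BorelSpace E] in
/-- Integrability of `u² · f` for `f` continuous on an open `U ⊇ supp u`. [folklore] -/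
theorem integrable_sq_mul_of_tsupport_subset [MeasurableSpace E] [BorelSpace E] {u f : E → ℝ}
    {U : Set E} (hU : IsOpen U) (hu : Continuous u) (huc : HasCompactSupport u)
    (huU : tsupport u ⊆ U) (hf : ContinuousOn f U) :
    Integrable fun z ↦ u z ^ 2 * f z := by
  have h2 : (fun z ↦ u z ^ 2 * f z) = fun z ↦ u z * (u z * f z) := by funext z; ring
  rw [h2]
  have hc : Continuous fun z ↦ u z * f z := continuous_mul_of_tsupport_subset hU hu huU hf
  exact (hu.mul hc).integrable_of_hasCompactSupport huc.mul_right

/-- On the shell, `e^{2v} = e^{−2s/x} x^{2t}` (`x = ρ − r > 0`). [folklore] -/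
theorem exp_two_mul_bdryWeight {ρ s t r : ℝ} (hr : r < ρ) :
    Real.exp (2 * bdryWeight ρ s t r) = Real.exp (-2 * s / (ρ - r)) * (ρ - r) ^ (2 * t) := by
  have hx : 0 < ρ - r := by linarith
  rw [bdryWeight, mul_add, Real.exp_add, Real.rpow_def_of_pos hx]
  congr 1
  · congr 1; rw [div_eq_mul_inv]; ring
  · congr 1; ring

/-- **Chruściel–Delay 2003, Prop. C.4, for the flat ball `B(z₀, ρ)`**: for all `s, t` and
`ε > 0` there is `x₁ ∈ (0, ρ/2]` such that every `u ∈ C¹_c` supported in the shell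
`{ρ − x₁ < |z − z₀| < ρ}` satisfies
`(s² − ε) ∫ e^{−2s/x} x^{2t−4} u² ≤ ∫ e^{−2s/x} x^{2t} |∇u|²`, `x = ρ − |z − z₀|`.
[cite: ChruscielDelay2003, Appendix C, Prop. C.4] -/
theorem integral_shell_weight_mul_sq_le (z₀ : E) {ρ : ℝ} (hρ : 0 < ρ) (s t : ℝ) {ε : ℝ}
    (hε : 0 < ε) :
    ∃ x₁ : ℝ, 0 < x₁ ∧ x₁ ≤ ρ / 2 ∧ ∀ u : E → ℝ, ContDiff ℝ 1 u → HasCompactSupport u →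
      tsupport u ⊆ {z | ρ - x₁ < ‖z - z₀‖ ∧ ‖z - z₀‖ < ρ} →
      (s ^ 2 - ε) * ∫ z, Real.exp (-2 * s / (ρ - ‖z - z₀‖)) * (ρ - ‖z - z₀‖) ^ (2 * t - 4) *
          u z ^ 2 ≤
        ∫ z, Real.exp (-2 * s / (ρ - ‖z - z₀‖)) * (ρ - ‖z - z₀‖) ^ (2 * t) *
          ∑ i, fderiv ℝ u z (b i) ^ 2 := by
  -- the constants
  set m : ℝ := (Fintype.card ι : ℝ) - 1 with hm
  set C₀ : ℝ := 2 * |s| * |t| + 2 * |s| + |t| + 2 * |m| * (|s| + |t|) / ρ with hC₀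
  have hC₀ : 0 ≤ C₀ := by positivity
  set x₁ : ℝ := min (min 1 (ρ / 2)) (ε / (C₀ + 1)) with hx₁
  have hx₁pos : 0 < x₁ := lt_min (lt_min one_pos (by positivity)) (by positivity)
  have hx₁1 : x₁ ≤ 1 := (min_le_left _ _).trans (min_le_left _ _)
  have hx₁ρ : x₁ ≤ ρ / 2 := (min_le_left _ _).trans (min_le_right _ _)
  have hx₁C : x₁ * C₀ ≤ ε := by
    have h1 : x₁ ≤ ε / (C₀ + 1) := min_le_right _ _
    calc x₁ * C₀ ≤ ε / (C₀ + 1) * C₀ := mul_le_mul_of_nonneg_right h1 hC₀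
      _ ≤ ε / (C₀ + 1) * (C₀ + 1) := mul_le_mul_of_nonneg_left (by linarith) (by positivity)
      _ = ε := by field_simp
  refine ⟨x₁, hx₁pos, hx₁ρ, fun u hu huc huS ↦ ?_⟩
  set S : Set E := {z | ρ - x₁ < ‖z - z₀‖ ∧ ‖z - z₀‖ < ρ} with hS_def
  have hS : IsOpen S := by
    have hc : Continuous fun z : E ↦ ‖z - z₀‖ := (continuous_id.sub continuous_const).norm
    exact (isOpen_lt continuous_const hc).inter (isOpen_lt hc continuous_const)
  have hSr : ∀ z ∈ S, ρ / 2 < ‖z - z₀‖ ∧ ‖z - z₀‖ < ρ := fun z hz ↦ ⟨by linarith [hz.1], hz.2⟩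
  have hSne : ∀ z ∈ S, z - z₀ ≠ 0 := fun z hz ↦ by
    rw [← norm_pos_iff]; linarith [(hSr z hz).1]
  -- the weight
  set F := bdryWeight ρ s t with hF
  set v : E → ℝ := fun z ↦ F ‖z - z₀‖ with hv
  have hvS : ContDiffOn ℝ 2 v S := fun z hz ↦
    ((contDiffAt_bdryWeight (hSr z hz).2).comp z
      ((contDiffAt_id.sub contDiffAt_const).norm ℝ (hSne z hz))).contDiffWithinAt
  -- Prop. C.2 with `w = 0`
  have hC2 := integral_exp_weight_mul_sq_le_of_subset b hS hu huc huS hvS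
    (contDiffOn_const (c := (0 : ℝ)))
  simp only [fderiv_fun_const, Pi.zero_apply, _root_.zero_apply,
    Finset.sum_const_zero, add_zero, ne_eq, OfNat.ofNat_ne_zero, not_false_eq_true, zero_pow,
    sub_zero] at hC2
  -- the radial identities on `S`
  have hu0 : Continuous u := hu.continuous
  have hrad : ∀ z ∈ S,
      (∑ i, fderiv ℝ v z (b i) ^ 2 = bdryWeight₁ ρ s t ‖z - z₀‖ ^ 2) ∧
      ∑ i, fderiv ℝ (fun y ↦ fderiv ℝ v y (b i)) z (b i) =
        bdryWeight₂ ρ s t ‖z - z₀‖ + m * bdryWeight₁ ρ s t ‖z - z₀‖ / ‖z - z₀‖ := by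
    intro z hz
    have hR := radial_sums b (F := F) (F₁ := bdryWeight₁ ρ s t) (F₂ := bdryWeight₂ ρ s t)
      (R := Ioo (ρ / 2) ρ) isOpen_Ioo (fun r hr ↦ by linarith [hr.1])
      (fun r hr ↦ hasDerivAt_bdryWeight hr.2) (fun r hr ↦ hasDerivAt_bdryWeight₁ hr.2)
      (z := z - z₀) (hSr z hz)
    have h1 : ∀ y, fderiv ℝ v y = fderiv ℝ (fun w : E ↦ F ‖w‖) (y - z₀) := fun y ↦
      fderiv_comp_sub (𝕜 := ℝ) (f := fun w : E ↦ F ‖w‖) (x := y) z₀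
    have h2 : ∀ i, fderiv ℝ (fun y ↦ fderiv ℝ v y (b i)) z =
        fderiv ℝ (fun w : E ↦ fderiv ℝ (fun w : E ↦ F ‖w‖) w (b i)) (z - z₀) := fun i ↦ by
      have hfun : (fun y ↦ fderiv ℝ v y (b i)) =
          fun y ↦ (fun w : E ↦ fderiv ℝ (fun w : E ↦ F ‖w‖) w (b i)) (y - z₀) := by
        funext y; rw [h1 y]
      rw [hfun, fderiv_comp_sub (𝕜 := ℝ) (f := fun w : E ↦ fderiv ℝ (fun w : E ↦ F ‖w‖) w (b i)) (x := z) z₀]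
    simp_rw [h1 z, h2]
    rw [hm]
    exact hR
  -- the pointwise lower bound on `S`
  have hlow : ∀ z ∈ S, (s ^ 2 - ε) / (ρ - ‖z - z₀‖) ^ 4 ≤
      bdryWeight₂ ρ s t ‖z - z₀‖ + m * bdryWeight₁ ρ s t ‖z - z₀‖ / ‖z - z₀‖ +
        bdryWeight₁ ρ s t ‖z - z₀‖ ^ 2 := by
    intro z hz
    have hx : 0 < ρ - ‖z - z₀‖ := by linarith [(hSr z hz).2]
    have hx1 : ρ - ‖z - z₀‖ ≤ 1 := by linarith [hz.1]
    have hxC : (ρ - ‖z - z₀‖) * (2 * |s| * |t| + 2 * |s| + |t| + 2 * |m| * (|s| + |t|) / ρ) ≤ ε :=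
      le_trans (mul_le_mul_of_nonneg_right (by linarith [hz.1]) hC₀) hx₁C
    have h := weight_lower_bound (s := s) (t := t) (m := m) hρ hx hx1 (hSr z hz).1.le rfl hxC
    simp only [bdryWeight₁, bdryWeight₂]
    linarith
  -- comparison of the integrands
  set r : E → ℝ := fun z ↦ ‖z - z₀‖ with hr
  have hrc : Continuous r := (continuous_id.sub continuous_const).norm
  have hxS : ∀ z ∈ S, ρ - r z ≠ 0 := fun z hz ↦ by
    have := (hSr z hz).2; simp only [hr]; linarith
  have hrS : ∀ z ∈ S, r z ≠ 0 := fun z hz ↦ by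
    have := (hSr z hz).1; simp only [hr]; linarith
  have hexpS : ContinuousOn (fun z ↦ Real.exp (-2 * s / (ρ - r z))) S :=
    Real.continuous_exp.comp_continuousOn
      ((continuousOn_const).div (continuousOn_const.sub hrc.continuousOn) hxS)
  have hpowS : ∀ p : ℝ, ContinuousOn (fun z ↦ (ρ - r z) ^ p) S := fun p ↦
    (continuousOn_const.sub hrc.continuousOn).rpow_const fun z hz ↦ Or.inl (hxS z hz)
  have hF₁S : ContinuousOn (fun z ↦ bdryWeight₁ ρ s t (r z)) S := by
    simp only [bdryWeight₁]
    exact ((continuousOn_const.div ((continuousOn_const.sub hrc.continuousOn).pow 2)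
      (fun z hz ↦ pow_ne_zero 2 (hxS z hz))).add
      (continuousOn_const.div (continuousOn_const.sub hrc.continuousOn) hxS)).neg
  have hF₂S : ContinuousOn (fun z ↦ bdryWeight₂ ρ s t (r z)) S := by
    simp only [bdryWeight₂]
    exact ((continuousOn_const.div ((continuousOn_const.sub hrc.continuousOn).pow 3)
      (fun z hz ↦ pow_ne_zero 3 (hxS z hz))).add
      (continuousOn_const.div ((continuousOn_const.sub hrc.continuousOn).pow 2)
      (fun z hz ↦ pow_ne_zero 2 (hxS z hz)))).neg
  -- the weight function `e^{2v} Q` on `S`, `Q = F₂ + m F₁/r + F₁²`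
  set Qw : E → ℝ := fun z ↦ Real.exp (-2 * s / (ρ - r z)) * (ρ - r z) ^ (2 * t) *
    (bdryWeight₂ ρ s t (r z) + m * bdryWeight₁ ρ s t (r z) / r z + bdryWeight₁ ρ s t (r z) ^ 2)
    with hQw
  have hQwS : ContinuousOn Qw S :=
    ((hexpS.mul (hpowS _)).mul ((hF₂S.add ((continuousOn_const.mul hF₁S).div hrc.continuousOn
      hrS)).add (hF₁S.pow 2)))
  -- identify the integrand of Prop. C.2
  have hident : (fun x ↦ Real.exp (2 * v x) *
      (∑ i, fderiv ℝ (fun y ↦ fderiv ℝ v y (b i)) x (b i) + ∑ i, fderiv ℝ v x (b i) ^ 2) *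
        u x ^ 2) = fun z ↦ u z ^ 2 * Qw z := by
    funext z
    by_cases hz : z ∈ tsupport u
    · have hzS := huS hz
      rw [(hrad z hzS).1, (hrad z hzS).2, hQw]
      simp only [hv, hF, hr, exp_two_mul_bdryWeight (hSr z hzS).2]
      ring
    · simp [image_eq_zero_of_notMem_tsupport hz]
  rw [hident] at hC2
  -- the lower integrand
  set Lw : E → ℝ := fun z ↦ Real.exp (-2 * s / (ρ - r z)) * (ρ - r z) ^ (2 * t - 4) with hLw
  have hLwS : ContinuousOn Lw S := hexpS.mul (hpowS _)
  have hLint : Integrable fun z ↦ u z ^ 2 * Lw z :=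
    integrable_sq_mul_of_tsupport_subset hS hu0 huc huS hLwS
  have hQint : Integrable fun z ↦ u z ^ 2 * Qw z :=
    integrable_sq_mul_of_tsupport_subset hS hu0 huc huS hQwS
  have hptw : ∀ z, (s ^ 2 - ε) * (u z ^ 2 * Lw z) ≤ u z ^ 2 * Qw z := by
    intro z
    by_cases hz : z ∈ tsupport u
    · have hzS := huS hz
      have hx : 0 < ρ - r z := by have := (hSr z hzS).2; simp only [hr]; linarith
      have hsplit : (ρ - r z) ^ (2 * t - 4) = (ρ - r z) ^ (2 * t) / (ρ - r z) ^ 4 := by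
        rw [Real.rpow_sub hx, show (4 : ℝ) = ((4 : ℕ) : ℝ) by norm_num, Real.rpow_natCast]
      have hle := hlow z hzS
      simp only [hLw, hQw]
      rw [hsplit]
      have hpos : 0 ≤ u z ^ 2 * (Real.exp (-2 * s / (ρ - r z)) * (ρ - r z) ^ (2 * t)) :=
        mul_nonneg (sq_nonneg _) (mul_nonneg (Real.exp_pos _).le (Real.rpow_nonneg hx.le _))
      have hx4 : 0 < (ρ - r z) ^ 4 := by positivity
      calc (s ^ 2 - ε) * (u z ^ 2 * (Real.exp (-2 * s / (ρ - r z)) * ((ρ - r z) ^ (2 * t) /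
            (ρ - r z) ^ 4)))
          = u z ^ 2 * (Real.exp (-2 * s / (ρ - r z)) * (ρ - r z) ^ (2 * t)) *
              ((s ^ 2 - ε) / (ρ - r z) ^ 4) := by
            field_simp
        _ ≤ u z ^ 2 * (Real.exp (-2 * s / (ρ - r z)) * (ρ - r z) ^ (2 * t)) *
              (bdryWeight₂ ρ s t (r z) + m * bdryWeight₁ ρ s t (r z) / r z +
                bdryWeight₁ ρ s t (r z) ^ 2) := mul_le_mul_of_nonneg_left hle hpos
        _ = _ := by ring
    · simp [image_eq_zero_of_notMem_tsupport hz]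
  have hstep : (s ^ 2 - ε) * ∫ z, u z ^ 2 * Lw z ≤ ∫ z, u z ^ 2 * Qw z := by
    rw [← integral_const_mul]
    exact integral_mono (hLint.const_mul _) hQint (fun z ↦ hptw z)
  -- the upper integrand
  have hupper : (fun x ↦ Real.exp (2 * v x) * ∑ i, fderiv ℝ u x (b i) ^ 2) =
      fun z ↦ Real.exp (-2 * s / (ρ - ‖z - z₀‖)) * (ρ - ‖z - z₀‖) ^ (2 * t) *
        ∑ i, fderiv ℝ u z (b i) ^ 2 := by
    funext z
    by_cases hz : z ∈ tsupport u
    · have hzS := huS hz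
      simp only [hv, hF, exp_two_mul_bdryWeight (hSr z hzS).2]
    · simp [fderiv_apply_eq_zero_of_notMem_tsupport hz]
  rw [hupper] at hC2
  have hLeq : (fun z ↦ u z ^ 2 * Lw z) = fun z ↦
      Real.exp (-2 * s / (ρ - ‖z - z₀‖)) * (ρ - ‖z - z₀‖) ^ (2 * t - 4) * u z ^ 2 := by
    funext z; simp only [hLw, hr]; ring
  rw [hLeq] at hstep
  exact hstep.trans hC2

end Shell

end WeightedPoincare

end Literature.Analysis.PDE

end
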